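import Mathlib
import Summits.Ventures.PercRepro2.V1SeriesClosure
import Summits.Ventures.PercRepro2.PatternHallHarris

/-! # (UH) — the down-set Hall form of (U) — holds on every series–parallel pattern
(seat mine-b, cell pub-perc-repro2; conjectures/MINE-B.md §20)

`DownDom` (V1ParallelClosure.lean) is the universal subset Hall form (UH) of the level-summed row
(U): every lower set of the configuration cube of a pattern has non-negative mass for
`ν = [F_R = 1] − F_B·[F_R = 0]`; by Hall's theorem every configuration with `F_R = 0`, `F_B = a`
owns `a` private configurations below it with `F_R = 1`.  It is closed under parallel composition
(`downDom_par`) and — given the capped Harris inequalities on the parts — under series composition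
(`downDom_ser`, V1SeriesClosure.lean).  Here the capped Harris inequalities are proved on EVERY
pattern cube (`capHarris_pattern`: Harris–Kleitman twice on `{F_R ≥ j}` (lower) and `{F_B ≥ j}`
(upper), `#{F_R ≥ j} = #{F_B ≥ j}` by the colour swap), the two compositions are transported along
`splitIso` (`downDom_series_pattern`, `downDom_parallel_pattern`), the atoms are checked, and the
induction over `IsSP` gives **`IsSP.downDom`**: (UH) on every series–parallel pattern, at graph level. -/

open Finset

namespace Summit.Ventures.PercRepro2.V2Closure

open Summit.Ventures.PercRepro2.UHClosure

section Transport

variable {X X' : Type*} [Preorder X] [Preorder X'] [Fintype X] [Fintype X'] [DecidableEq X']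

/-- non-negativity on all lower sets transports along an order isomorphism -/
theorem lower_nonneg_of_orderIso (e : X ≃o X') (f : X → ℤ) (f' : X' → ℤ) (hf : ∀ x, f' (e x) = f x)
    (h : ∀ V : Finset X, IsLowerSet (↑V : Set X) → 0 ≤ ∑ x ∈ V, f x) :
    ∀ V' : Finset X', IsLowerSet (↑V' : Set X') → 0 ≤ ∑ x' ∈ V', f' x' := by
  intro V' hV'
  have hV : IsLowerSet (↑(univ.filter (fun x : X => e x ∈ V')) : Set X) := by
    intro x y hxy hx
    simp only [coe_filter, mem_univ, true_and, Set.mem_setOf_eq] at hx ⊢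
    exact hV' (e.monotone hxy) hx
  have := h _ hV
  rw [Finset.sum_filter] at this
  have e1 : ∑ x' ∈ V', f' x' = ∑ x', (if x' ∈ V' then f' x' else 0) := by
    rw [Finset.sum_ite_mem, Finset.univ_inter]
  have e2 : ∑ x', (if x' ∈ V' then f' x' else 0) = ∑ x, (if e x ∈ V' then f x else 0) := by
    rw [← Fintype.sum_equiv e.toEquiv (fun x => if e x ∈ V' then f x else 0)
      (fun x' => if x' ∈ V' then f' x' else 0)]
    intro x
    simp only [OrderIso.coe_toEquiv, hf]
  rw [e1, e2]; exact this

/-- (UH) transports along a label-preserving order isomorphism -/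
theorem downDom_of_orderIso (e : X ≃o X') (r b : X → ℕ) (r' b' : X' → ℕ) (hr : ∀ x, r' (e x) = r x)
    (hb : ∀ x, b' (e x) = b x) (h : DownDom r b) : DownDom r' b' :=
  lower_nonneg_of_orderIso e (nu r b) (nu r' b') (fun x => by simp only [nu, hr, hb]) h

end Transport

section Harris

variable {V : Type*} {E : Type*} [DecidableEq E] [Fintype E]

/-- the two level sets `{F_B ≥ j}` and `{F_R ≥ j}` have the same size (the colour swap exchanges them) -/
lemma card_blue_ge_eq_red_ge (ends : E → Sym2 V) (s t : V) (O Y : Finset E) (j : ℕ) :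
    (univ.filter (fun S : Conf Y => j ≤ bLabP ends s t O Y S)).card
      = (univ.filter (fun S : Conf Y => j ≤ rLabP ends s t O Y S)).card := by
  apply Finset.card_bij (fun S _ => OrderDual.ofDual (swapIso Y S))
  · intro S hS
    simp only [mem_filter, mem_univ, true_and] at hS ⊢
    rw [rLabP_swap]; exact hS
  · intro S _ S' _ h
    exact (swapIso Y).injective (OrderDual.ofDual.injective h)
  · intro T hT
    refine ⟨(swapIso Y).symm (OrderDual.toDual T), ?_, by simp⟩
    simp only [mem_filter, mem_univ, true_and] at hT ⊢
    have := rLabP_swap ends s t O Y ((swapIso Y).symm (OrderDual.toDual T))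
    rw [OrderIso.apply_symm_apply, OrderDual.ofDual_toDual] at this
    rw [← this]; exact hT

/-- **the level Harris inequality on a pattern cube**: a lower set meets `{F_R ≥ j}` at least as
often as `{F_B ≥ j}` (Harris–Kleitman twice and the colour swap). -/
theorem harris_level_pattern {ends : E → Sym2 V} {s t : V} (hst : s ≠ t) (O Y : Finset E)
    (D : Finset (Conf Y)) (hD : IsLowerSet (↑D : Set (Conf Y))) (j : ℕ) :
    (D.filter (fun S => j ≤ bLabP ends s t O Y S)).card
      ≤ (D.filter (fun S => j ≤ rLabP ends s t O Y S)).card := by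
  set e := confEquiv Y
  set Bj : Finset (Conf Y) := univ.filter (fun S => j ≤ bLabP ends s t O Y S) with hBj
  set Rj : Finset (Conf Y) := univ.filter (fun S => j ≤ rLabP ends s t O Y S) with hRj
  have hBu : IsUpperSet (↑Bj : Set (Conf Y)) := by
    intro S T hST hS
    simp only [hBj, coe_filter, mem_univ, true_and, Set.mem_setOf_eq] at hS ⊢
    exact hS.trans (bLabP_mono hst O Y hST)
  have hRl : IsLowerSet (↑Rj : Set (Conf Y)) := by
    intro S T hTS hS
    simp only [hRj, coe_filter, mem_univ, true_and, Set.mem_setOf_eq] at hS ⊢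
    exact hS.trans (rLabP_anti hst O Y hTS)
  have hinj : Function.Injective e := e.injective
  have h1 := (image_confEquiv_isLowerSet Y D hD).card_inter_le_finset (image_confEquiv_isUpperSet Y Bj hBu)
  have h2 := (image_confEquiv_isLowerSet Y D hD).le_card_inter_finset (image_confEquiv_isLowerSet Y Rj hRl)
  rw [← Finset.image_inter _ _ hinj, Finset.card_image_of_injective _ hinj,
    Finset.card_image_of_injective _ hinj, Finset.card_image_of_injective _ hinj] at h1
  rw [← Finset.image_inter _ _ hinj, Finset.card_image_of_injective _ hinj,
    Finset.card_image_of_injective _ hinj, Finset.card_image_of_injective _ hinj] at h2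
  have hcard : Bj.card = Rj.card := card_blue_ge_eq_red_ge ends s t O Y j
  have hDB : D.filter (fun S => j ≤ bLabP ends s t O Y S) = D ∩ Bj := by
    ext S; simp [hBj]
  have hDR : D.filter (fun S => j ≤ rLabP ends s t O Y S) = D ∩ Rj := by
    ext S; simp [hRj]
  rw [hDB, hDR]
  have hpos : 0 < 2 ^ Fintype.card ↥Y := by positivity
  have : 2 ^ Fintype.card ↥Y * (D ∩ Bj).card ≤ 2 ^ Fintype.card ↥Y * (D ∩ Rj).card := by
    calc 2 ^ Fintype.card ↥Y * (D ∩ Bj).card ≤ D.card * Bj.card := h1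
      _ = D.card * Rj.card := by rw [hcard]
      _ ≤ 2 ^ Fintype.card ↥Y * (D ∩ Rj).card := h2
  exact Nat.le_of_mul_le_mul_left this hpos

omit [DecidableEq E] [Fintype E] in
/-- `min n β` counts the `j < β` with `j + 1 ≤ n` -/
lemma min_eq_card_filter (n β : ℕ) : min n β = ((range β).filter (fun j => j + 1 ≤ n)).card := by
  have : (range β).filter (fun j => j + 1 ≤ n) = range (min n β) := by
    ext j; simp only [mem_filter, mem_range, lt_min_iff]; omega
  rw [this, card_range]

omit [DecidableEq E] [Fintype E] in
/-- a sum of capped labels is a sum of level counts -/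
lemma sum_min_eq {α : Type*} (D : Finset α) (f : α → ℕ) (β : ℕ) :
    ∑ x ∈ D, ((min (f x) β : ℕ) : ℤ) = ∑ j ∈ range β, ((D.filter (fun x => j + 1 ≤ f x)).card : ℤ) := by
  simp_rw [min_eq_card_filter, card_filter]
  push_cast
  rw [Finset.sum_comm]

/-- **the capped Harris inequalities on every pattern cube** -/
theorem capHarris_pattern {ends : E → Sym2 V} {s t : V} (hst : s ≠ t) (O Y : Finset E) :
    CapHarris (rLabP ends s t O Y) (bLabP ends s t O Y) := by
  intro D hD β
  rw [Finset.sum_sub_distrib, sum_min_eq, sum_min_eq, ← Finset.sum_sub_distrib]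
  apply Finset.sum_nonneg
  intro j _
  have := harris_level_pattern (ends := ends) hst O Y D hD (j + 1)
  have h' : ((D.filter (fun S => j + 1 ≤ bLabP ends s t O Y S)).card : ℤ)
      ≤ ((D.filter (fun S => j + 1 ≤ rLabP ends s t O Y S)).card : ℤ) := by exact_mod_cast this
  linarith

end Harris

section Patterns

variable {V : Type*} {E : Type*} [DecidableEq E] [Fintype E]

/-- **(UH) passes to a series composition of patterns** (capped Harris supplied by the cubes) -/
theorem downDom_series_pattern {ends : E → Sym2 V} {s v t : V} {O₁ Y₁ O₂ Y₂ : Finset E}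
    (hE : SharesOnlyVertex ends v (O₁ ∪ Y₁) (O₂ ∪ Y₂)) (hs : ∀ e ∈ O₂ ∪ Y₂, s ∉ ends e)
    (ht : ∀ e ∈ O₁ ∪ Y₁, t ∉ ends e) (hsv : s ≠ v) (htv : t ≠ v) (hst : s ≠ t)
    (hdisj : Disjoint (O₁ ∪ Y₁) (O₂ ∪ Y₂)) (hdY : Disjoint Y₁ Y₂)
    (h₁ : DownDom (rLabP ends s v O₁ Y₁) (bLabP ends s v O₁ Y₁))
    (h₂ : DownDom (rLabP ends v t O₂ Y₂) (bLabP ends v t O₂ Y₂)) :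
    DownDom (rLabP ends s t (O₁ ∪ O₂) (Y₁ ∪ Y₂)) (bLabP ends s t (O₁ ∪ O₂) (Y₁ ∪ Y₂)) := by
  have hl := labels_series hE hs ht hsv htv hst hdisj hdY
  exact downDom_of_orderIso (splitIso Y₁ Y₂ hdY).symm _ _ _ _ (fun p => (hl p).1) (fun p => (hl p).2)
    (downDom_ser _ _ _ _ h₁ (capHarris_pattern hsv O₁ Y₁) h₂ (capHarris_pattern htv.symm O₂ Y₂))

/-- **(UH) passes to a parallel composition of patterns** -/
theorem downDom_parallel_pattern [DecidableEq V] {ends : E → Sym2 V} {s t : V} {O₁ Y₁ O₂ Y₂ : Finset E}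
    (hE : SharesOnlyPair ends s t (O₁ ∪ Y₁) (O₂ ∪ Y₂)) (hst : s ≠ t)
    (hdisj : Disjoint (O₁ ∪ Y₁) (O₂ ∪ Y₂)) (hdY : Disjoint Y₁ Y₂)
    (h₁ : DownDom (rLabP ends s t O₁ Y₁) (bLabP ends s t O₁ Y₁))
    (h₂ : DownDom (rLabP ends s t O₂ Y₂) (bLabP ends s t O₂ Y₂)) :
    DownDom (rLabP ends s t (O₁ ∪ O₂) (Y₁ ∪ Y₂)) (bLabP ends s t (O₁ ∪ O₂) (Y₁ ∪ Y₂)) := by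
  have hl := labels_parallel hE hst hdisj hdY
  exact downDom_of_orderIso (splitIso Y₁ Y₂ hdY).symm _ _ _ _ (fun p => (hl p).1) (fun p => (hl p).2)
    (downDom_par _ _ _ _ h₁ h₂)

/-- the absent edge satisfies (UH): flows `(0, 0)` -/
theorem downDom_absent_atom (ends : E → Sym2 V) (s t : V) :
    DownDom (rLabP ends s t ∅ ∅) (bLabP ends s t ∅ ∅) := by
  have hr : ∀ S : Conf (∅ : Finset E), rLabP ends s t ∅ ∅ S = 0 := by
    intro S; unfold rLabP; rw [conf_empty_eq S]; simp [flow_empty]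
  have hb : ∀ S : Conf (∅ : Finset E), bLabP ends s t ∅ ∅ S = 0 := by
    intro S; unfold bLabP; rw [conf_empty_eq S]; simp [flow_empty]
  intro W _
  apply Finset.sum_nonneg; intro S _
  simp [nu, hr, hb]

/-- the pinned edge satisfies (UH): flows `(1, 1)` -/
theorem downDom_pin_atom {ends : E → Sym2 V} {s t : V} (hst : s ≠ t) {f : E} (hf : ends f = s(s, t)) :
    DownDom (rLabP ends s t {f} ∅) (bLabP ends s t {f} ∅) := by
  have hr : ∀ S : Conf (∅ : Finset E), rLabP ends s t {f} ∅ S = 1 := by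
    intro S; unfold rLabP; rw [conf_empty_eq S]; simp [flow_single hst hf]
  have hb : ∀ S : Conf (∅ : Finset E), bLabP ends s t {f} ∅ S = 1 := by
    intro S; unfold bLabP; rw [conf_empty_eq S]; simp [flow_single hst hf]
  intro W _
  apply Finset.sum_nonneg; intro S _
  simp [nu, hr]

/-- the free edge satisfies (UH): the red state `(1, 0)` pays for the blue state `(0, 1)` above it -/
theorem downDom_free_atom {ends : E → Sym2 V} {s t : V} (hst : s ≠ t) {f : E} (hf : ends f = s(s, t)) :
    DownDom (rLabP ends s t ∅ {f}) (bLabP ends s t ∅ {f}) := by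
  have hr : ∀ S : Conf ({f} : Finset E), rLabP ends s t ∅ {f} S = if S.1 = ∅ then 1 else 0 := by
    intro S; unfold rLabP
    rcases conf_single_cases S with h | h <;> rw [h] <;> simp [flow_single hst hf, flow_empty]
  have hb : ∀ S : Conf ({f} : Finset E), bLabP ends s t ∅ {f} S = if S.1 = ∅ then 0 else 1 := by
    intro S; unfold bLabP
    rcases conf_single_cases S with h | h <;> rw [h] <;> simp [flow_single hst hf, flow_empty]
  intro W hW
  set e0 : Conf ({f} : Finset E) := ⟨∅, Finset.empty_subset _⟩ with he0
  set e1 : Conf ({f} : Finset E) := ⟨{f}, le_rfl⟩ with he1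
  have k : ∀ S : Conf ({f} : Finset E), nu (rLabP ends s t ∅ {f}) (bLabP ends s t ∅ {f}) S
      = (if S = e0 then 1 else 0) - (if S = e1 then 1 else 0) := by
    intro S
    rw [nu, hr, hb]
    rcases conf_single_cases S with h | h
    · have : S = e0 := Subtype.ext h
      simp [this, he0, he1]
    · have : S = e1 := Subtype.ext h
      simp [this, he0, he1]
  simp only [k, Finset.sum_sub_distrib, Finset.sum_ite_eq']
  by_cases h1 : e1 ∈ W
  · have h0 : e0 ∈ W := hW (show e0 ≤ e1 from Finset.empty_subset _) h1
    simp [h0, h1]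
  · simp [h1]
    split_ifs <;> simp

end Patterns

section SP

variable {V : Type*} {E : Type*} [DecidableEq V] [DecidableEq E] [Fintype E]

/-- **(UH) — the down-set Hall form of (U) — holds on every series–parallel pattern**: every lower set
of the configuration cube carries non-negative `ν`-mass for the flow labels. -/
theorem IsSP.downDom {ends : E → Sym2 V} {s t : V} {O Y : Finset E} (h : IsSP ends s t O Y) :
    DownDom (rLabP ends s t O Y) (bLabP ends s t O Y) := by
  induction h with
  | free hst hf => exact downDom_free_atom hst hf
  | pin hst hf => exact downDom_pin_atom hst hf
  | absent => exact downDom_absent_atom ends _ _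
  | ser _ _ hE hs ht hsv htv hst hdisj hdY ih₁ ih₂ =>
      exact downDom_series_pattern hE hs ht hsv htv hst hdisj hdY ih₁ ih₂
  | par _ _ hE hst hdisj hdY ih₁ ih₂ =>
      exact downDom_parallel_pattern hE hst hdisj hdY ih₁ ih₂

/-- The count (U) of a series–parallel pattern, read from (UH) on the whole cube:
`#{F_R = 1} ≥ Σ_{F_R = 0} F_B`. -/
theorem IsSP.sum_nu_nonneg {ends : E → Sym2 V} {s t : V} {O Y : Finset E} (h : IsSP ends s t O Y) :
    0 ≤ ∑ S : Conf Y, nu (rLabP ends s t O Y) (bLabP ends s t O Y) S :=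
  h.downDom univ (by simp [isLowerSet_univ])

end SP

end Summit.Ventures.PercRepro2.V2Closure
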